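import Summits.SmoothPoincare4.SmoothPoincare4.Theses.VerlindeRLinks
import Literature.Topology.FourManifolds.RLinkSphereExistence
import HarnessLib

/-!
# Helper `helper_closesAlt` of line `sphere_split` (crux `VerlindeRLinks.VrlSliceRigidity`,
# item stmt-SmoothPoincare4-16179): the route re-glued on the heart — SLIDE GAP ∧ GPRC_std ⇒ ¬SPC4

The line `sphere_split` cuts the crux `VrlSliceRigidity` (slice-component R-links slide strictly
to the unlink) through the closed manifold `Σ_L` of an R-link into "every R-link has a closed
manifold" (KNOWN — and since 2026-08-17 a THEOREM, `Literature.….exists_isRLinkSphere`),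
"component sliceness detects exotic R-link spheres" (stub S1, open, exotica axis) and the heart
"GPRC on the standard sphere" (stub S2 `stub_stdSphereSlides`, open, the whole Andrews–Curtis
content).  This file CERTIFIES the strategist's observation (`converse.lean`, `closes_alt`,
2026-08-17; idea `reglue-standard-sphere`) that the route's deciding theorem needs from this crux
ONLY the heart: from the slide gap (`VrlSlideGap` = ¬ printed GPRC, the route's other crux) and S2
alone — no slice hypothesis, no S1, no `VrlComponentsHBallSlice`, no FGMW lemma — one gets
`¬ SmoothPoincare4`: the gap R-link `L₀` has a closed manifold `X₀` (`exists_isRLinkSphere`), a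
homotopy `4`-sphere (`IsRLinkSphere.nonempty_homotopyEquiv_sphere_holds`); were `X₀ ≅ S⁴` — which
`SmoothPoincare4` forces — S2 would slide `L₀` to a `0`-framed unlink, contradicting the gap.  So
the planner may re-glue `closes` on (VrlSlideGap, S2 promoted to an item) and drop S1 and the
slice detour from the cone (Gompf–Scharlemann–Thompson 2010, Prop. 9.2 is exactly this dichotomy:
"the generalized Property R conjecture [on the standard sphere] … is equivalent to the smooth
`4`-dimensional Poincaré conjecture for homotopy spheres without `1`-handles", read on the negative
side).

## References

* R. E. Gompf, M. Scharlemann, A. Thompson, Geom. Topol. 14 (2010) 2305–2347, §9 and Prop. 9.2.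
  [GompfScharlemannThompson2010]
-/

open scoped Manifold ContDiff Topology
open Set Function Literature.Topology.FourManifolds

noncomputable section

-- every `Summit.SmoothPoincare4.SmoothPoincare4.…` name repeats the summit = sub-problem segment
-- (D-0017 layout); the duplicate is deliberate.
set_option linter.dupNamespace false

namespace Summit.SmoothPoincare4.SmoothPoincare4.Theorems.VrlSliceRigidity.SphereSplit

/-- **Helper `helper_closesAlt` — the slide gap and GPRC on the standard sphere refute SPC4**
(Gompf–Scharlemann–Thompson 2010, Prop. 9.2 on the negative side): if some R-link `L₀` is not
strictly handle-slide equivalent to any `0`-framed unlink (`VrlSlideGap`), and every R-link whose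
closed manifold `Σ_L` is diffeomorphic to `S⁴` IS strictly slide-equivalent to a `0`-framed unlink
(the heart S2 of line `sphere_split`, verbatim), then `SmoothPoincare4` fails: `Σ_{L₀}` exists
(`exists_isRLinkSphere`) and is a homotopy sphere (`IsRLinkSphere.nonempty_homotopyEquiv_sphere_holds`),
so SPC4 would make it standard and S2 would slide `L₀` to the unlink — contradiction.  CONDITIONAL
in both hypotheses (two open cruxes); it certifies that the route needs nothing else from
`VrlSliceRigidity`. [cite: GompfScharlemannThompson2010, Prop. 9.2 and §9] -/
theorem helper_closesAlt :
    Summit.SmoothPoincare4.SmoothPoincare4.Theses.VerlindeRLinks.VrlSlideGap →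
      (∀ [Knot.TubularNbhd.SmoothnessFacts] (n : ℕ) (L : FramedLink (Fin n)) (Y : Type)
        [TopologicalSpace Y] [T2Space Y] [SecondCountableTopology Y]
        [ChartedSpace (EuclideanSpace ℝ (Fin 3)) Y] [IsManifold (𝓡 3) ∞ Y] [CompactSpace Y]
        [ConnectedSpace Y], IsSphereTwoProdCircleSum n Y → L.IsSurgery (𝓡 3) Y →
          ∀ (X : Type) [TopologicalSpace X] [T2Space X] [SecondCountableTopology X]
            [ChartedSpace (EuclideanSpace ℝ (Fin 4)) X] [IsManifold (𝓡 4) ∞ X],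
            IsRLinkSphere X L →
              Nonempty (X ≃ₘ⟮𝓡 4, 𝓡 4⟯ (Metric.sphere (0 : EuclideanSpace ℝ (Fin 5)) 1)) →
                ∃ U : FramedLink (Fin n),
                  U.IsZeroFramedUnlink ∧ IsStrictHandleSlideEquivalent ⟨n, L⟩ ⟨n, U⟩) →
        ¬ SmoothPoincare4 := by
  intro hgap h2 hS
  obtain ⟨iν, n, L, Y, i₁, i₂, i₃, i₄, i₅, i₆, i₇, hY, hL, hno⟩ := hgap
  -- the gap R-link has a closed manifold, a homotopy `4`-sphere
  obtain ⟨X, _, _, _, _, _, hX⟩ := exists_isRLinkSphere L Y hY hL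
  obtain ⟨e⟩ := IsRLinkSphere.nonempty_homotopyEquiv_sphere_holds n L X hX
  -- SPC4 makes it standard …
  have hstd : Nonempty (X ≃ₘ⟮𝓡 4, 𝓡 4⟯ (Metric.sphere (0 : EuclideanSpace ℝ (Fin 5)) 1)) :=
    hS X ‹_› ‹_› e
  -- … and then GPRC on the standard sphere slides `L` to a `0`-framed unlink: the gap is violated
  obtain ⟨U, hU, hLU⟩ := @h2 iν n L Y i₁ i₂ i₃ i₄ i₅ i₆ i₇ hY hL X _ ‹_› ‹_› _ ‹_› hX hstd
  exact hno U hU hLU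

end Summit.SmoothPoincare4.SmoothPoincare4.Theorems.VrlSliceRigidity.SphereSplit

end
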